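import Summits.Ventures.PercRepro.C026TwoCluster

/-!
# The interior flip of a blue cluster (mine-3 §41 (c); p6, gen 18)

For a configuration `S` and a vertex `j`, the **interior flip** `σ_j(S)` flips every edge with both
endpoints in the blue cluster `Y = cluster Sᶜ j` of `j` (the boundary of `Y`, which is red, is
untouched).  mine-3's LEMMA (interior flip), proofs/MINE3-GLUING.md §41 (c), in the tree's vocabulary:

* red connectivity survives (`conn_interiorFlip`): every `S`-red connection is rerouted through the
  old blue spanning structure of `Y`, which is now red (`walkInside_interiorFlip_of_mem`);
* the blue clusters of the vertices outside `Y` are unchanged (`cluster_compl_interiorFlip_of_not_mem`)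
  and the new blue cluster of any vertex of `Y` stays inside `Y` (`mem_of_conn_compl_interiorFlip`);
  hence a `(D,A)` configuration stays `(D,A)` (`interiorFlip_D`, `interiorFlip_A`);
* **the Good-criterion** (`good_interiorFlip_iff`): with `D_t = cluster Sᶜ t` disjoint from `Y` (a
  second mark `t`), `c` reaches `j` in `σ_j(S)` avoiding `D_t` iff `c` reaches `j` in `S` avoiding
  `D_t` or the red reach of `c` in `S` avoiding `D_t` meets `Y` — for a `Bad_t` source, `σ_j(S) ∈ Good_t`
  iff `R_t(S) ∩ D_j(S) ≠ ∅`.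
-/

namespace PercRepro

namespace MultiGraph

open Finset

variable {V E : Type*} (G : MultiGraph V E)

open Classical in
/-- Flip every edge with both endpoints in `Y`. -/
noncomputable def interiorFlip (ω : Config E) (Y : Set V) : Config E :=
  fun e => if G.fst e ∈ Y ∧ G.snd e ∈ Y then !ω e else ω e

variable {G}

/-- An edge with both endpoints in `Y` is flipped. -/
theorem interiorFlip_apply_of_both {ω : Config E} {Y : Set V} {e : E} (h1 : G.fst e ∈ Y)
    (h2 : G.snd e ∈ Y) : G.interiorFlip ω Y e = !ω e := by
  unfold interiorFlip
  rw [if_pos ⟨h1, h2⟩]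

/-- An edge with an endpoint outside `Y` is untouched. -/
theorem interiorFlip_apply_of_not_both {ω : Config E} {Y : Set V} {e : E}
    (h : ¬ (G.fst e ∈ Y ∧ G.snd e ∈ Y)) : G.interiorFlip ω Y e = ω e := by
  unfold interiorFlip
  rw [if_neg h]

/-- The complement of the flip is the flip of the complement. -/
theorem compl_interiorFlip (ω : Config E) (Y : Set V) :
    (G.interiorFlip ω Y)ᶜ = G.interiorFlip ωᶜ Y := by
  funext e
  by_cases h : G.fst e ∈ Y ∧ G.snd e ∈ Y
  · rw [Pi.compl_apply, interiorFlip_apply_of_both h.1 h.2, interiorFlip_apply_of_both h.1 h.2,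
      Pi.compl_apply]
    cases ω e <;> rfl
  · rw [Pi.compl_apply, interiorFlip_apply_of_not_both h, interiorFlip_apply_of_not_both h,
      Pi.compl_apply]

/-- An open edge with an endpoint outside `Y` is untouched by the flip. -/
theorem openAdj_interiorFlip_of_not_mem {ω : Config E} {Y : Set V} {x y : V} (hx : x ∉ Y)
    (h : G.OpenAdj ω x y) : G.OpenAdj (G.interiorFlip ω Y) x y := by
  obtain ⟨e, he, hend⟩ := h
  refine ⟨e, ?_, hend⟩
  rw [interiorFlip_apply_of_not_both]
  · exact he
  · rcases hend with ⟨h1, _⟩ | ⟨_, h2⟩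
    · exact fun hh => hx (h1 ▸ hh.1)
    · exact fun hh => hx (h2 ▸ hh.2)

/-- Conversely, an edge open after the flip with an endpoint outside `Y` was open before. -/
theorem openAdj_of_openAdj_interiorFlip_of_not_mem {ω : Config E} {Y : Set V} {x y : V}
    (hx : x ∉ Y) (h : G.OpenAdj (G.interiorFlip ω Y) x y) : G.OpenAdj ω x y := by
  obtain ⟨e, he, hend⟩ := h
  refine ⟨e, ?_, hend⟩
  rw [interiorFlip_apply_of_not_both] at he
  · exact he
  · rcases hend with ⟨h1, _⟩ | ⟨_, h2⟩
    · exact fun hh => hx (h1 ▸ hh.1)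
    · exact fun hh => hx (h2 ▸ hh.2)

/-- An edge closed in `ω` with both endpoints in `Y` is open after the flip. -/
theorem openAdj_interiorFlip_of_openAdj_compl {ω : Config E} {Y : Set V} {x y : V} (hx : x ∈ Y)
    (hy : y ∈ Y) (h : G.OpenAdj ωᶜ x y) : G.OpenAdj (G.interiorFlip ω Y) x y := by
  obtain ⟨e, he, hend⟩ := h
  refine ⟨e, ?_, hend⟩
  have hboth : G.fst e ∈ Y ∧ G.snd e ∈ Y := by
    rcases hend with ⟨h1, h2⟩ | ⟨h1, h2⟩
    · exact ⟨h1 ▸ hx, h2 ▸ hy⟩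
    · exact ⟨h1 ▸ hy, h2 ▸ hx⟩
  rw [interiorFlip_apply_of_both hboth.1 hboth.2]
  rw [Pi.compl_apply] at he
  cases hω : ω e
  · rfl
  · rw [hω] at he
    exact absurd he (by decide)

/-- Two vertices of the blue cluster `Y = cluster ωᶜ j` are joined, after the interior flip of `Y`,
by a walk inside `Y` (the old blue spanning structure of `Y`, now red). -/
theorem walkInside_interiorFlip_of_mem {ω : Config E} {j x y : V} (hx : x ∈ G.cluster ωᶜ j)
    (hy : y ∈ G.cluster ωᶜ j) :
    G.WalkInside (G.interiorFlip ω (G.cluster ωᶜ j)) (G.cluster ωᶜ j) x y := by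
  refine ⟨hx, ?_⟩
  have hxy : G.Conn ωᶜ x y := ((G.mem_cluster).1 hx).symm.trans ((G.mem_cluster).1 hy)
  refine Conn.induction (G := G) (ω := ωᶜ) (u := x)
    (motive := fun v => Relation.ReflTransGen
      (fun p q => G.OpenAdj (G.interiorFlip ω (G.cluster ωᶜ j)) p q ∧ q ∈ G.cluster ωᶜ j) x v)
    Relation.ReflTransGen.refl ?_ hxy
  intro p q hxp hpq ih
  have hp : p ∈ G.cluster ωᶜ j := (G.mem_cluster).2 (((G.mem_cluster).1 hx).trans hxp)
  have hq : q ∈ G.cluster ωᶜ j := (G.mem_cluster).2 (((G.mem_cluster).1 hp).trans (Conn.of_openAdj hpq))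
  exact ih.tail ⟨openAdj_interiorFlip_of_openAdj_compl hp hq hpq, hq⟩

/-- **Red connectivity survives the interior flip** of a blue cluster. -/
theorem conn_interiorFlip {ω : Config E} {j u v : V} (h : G.Conn ω u v) :
    G.Conn (G.interiorFlip ω (G.cluster ωᶜ j)) u v := by
  refine Conn.induction (G := G) (ω := ω) (u := u)
    (motive := fun w => G.Conn (G.interiorFlip ω (G.cluster ωᶜ j)) u w) (Conn.refl G _ u) ?_ h
  intro p q _ hpq ih
  by_cases hp : p ∈ G.cluster ωᶜ j
  · by_cases hq : q ∈ G.cluster ωᶜ j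
    · exact ih.trans (walkInside_interiorFlip_of_mem hp hq).conn
    · -- the edge has an endpoint outside `Y`
      exact ih.trans (Conn.of_openAdj (openAdj_interiorFlip_of_not_mem hq hpq.symm).symm)
  · exact ih.trans (Conn.of_openAdj (openAdj_interiorFlip_of_not_mem hp hpq))

/-- A blue walk (after the flip) from a vertex outside `Y` never enters `Y` and uses only old blue
edges: the blue cluster of a vertex outside `Y` is unchanged. -/
theorem cluster_compl_interiorFlip_of_not_mem {ω : Config E} {j t : V}
    (ht : t ∉ G.cluster ωᶜ j) :
    G.cluster (G.interiorFlip ω (G.cluster ωᶜ j))ᶜ t = G.cluster ωᶜ t := by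
  rw [compl_interiorFlip]
  ext v
  simp only [mem_cluster]
  constructor
  · intro h
    refine Conn.induction (G := G) (ω := G.interiorFlip ωᶜ (G.cluster ωᶜ j)) (u := t)
      (motive := fun w => G.Conn ωᶜ t w) (Conn.refl G _ t) ?_ h
    intro p q htp hpq ih
    have hp : p ∉ G.cluster ωᶜ j := fun hp =>
      ht ((G.mem_cluster).2 (((G.mem_cluster).1 hp).trans ih.symm))
    exact ih.trans (Conn.of_openAdj (openAdj_of_openAdj_interiorFlip_of_not_mem hp hpq))
  · intro h
    refine Conn.induction (G := G) (ω := ωᶜ) (u := t)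
      (motive := fun w => G.Conn (G.interiorFlip ωᶜ (G.cluster ωᶜ j)) t w) (Conn.refl G _ t) ?_ h
    intro p q htp hpq ih
    have hp : p ∉ G.cluster ωᶜ j := fun hp =>
      ht ((G.mem_cluster).2 (((G.mem_cluster).1 hp).trans htp.symm))
    exact ih.trans (Conn.of_openAdj (openAdj_interiorFlip_of_not_mem hp hpq))

/-- A blue walk (after the flip) from a vertex of `Y` stays inside `Y`. -/
theorem mem_of_conn_compl_interiorFlip {ω : Config E} {j x v : V} (hx : x ∈ G.cluster ωᶜ j)
    (h : G.Conn (G.interiorFlip ω (G.cluster ωᶜ j))ᶜ x v) : v ∈ G.cluster ωᶜ j := by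
  rw [compl_interiorFlip] at h
  refine Conn.induction (G := G) (ω := G.interiorFlip ωᶜ (G.cluster ωᶜ j)) (u := x)
    (motive := fun w => w ∈ G.cluster ωᶜ j) hx ?_ h
  intro p q _ hpq hp
  by_cases hq : q ∈ G.cluster ωᶜ j
  · exact hq
  · -- the edge has the endpoint `q` outside `Y`, so it is an old blue edge: `q` is blue-joined to `p`
    have hqp : G.OpenAdj ωᶜ q p := openAdj_of_openAdj_interiorFlip_of_not_mem hq hpq.symm
    exact (G.mem_cluster).2 (((G.mem_cluster).1 hp).trans (Conn.of_openAdj hqp).symm)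

/-- **The interior flip keeps red type `D`**: `c ~ a` and `c ~ b` survive. -/
theorem interiorFlip_D {S : Config E} {j a b c : V} (hca : G.Conn S c a) (hcb : G.Conn S c b) :
    G.Conn (G.interiorFlip S (G.cluster Sᶜ j)) c a ∧ G.Conn (G.interiorFlip S (G.cluster Sᶜ j)) c b :=
  ⟨conn_interiorFlip hca, conn_interiorFlip hcb⟩

/-- **The interior flip keeps blue type `A`**: if `j` is one of the three marks and the three blue
clusters are pairwise disjoint, they stay pairwise disjoint after the flip of the cluster of `j`
(`x, y` two marks other than `j`). -/
theorem interiorFlip_A {S : Config E} {j x y : V} (hjx : ¬ G.Conn Sᶜ j x) (hjy : ¬ G.Conn Sᶜ j y)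
    (hxy : ¬ G.Conn Sᶜ x y) :
    ¬ G.Conn (G.interiorFlip S (G.cluster Sᶜ j))ᶜ j x ∧
      ¬ G.Conn (G.interiorFlip S (G.cluster Sᶜ j))ᶜ j y ∧
      ¬ G.Conn (G.interiorFlip S (G.cluster Sᶜ j))ᶜ x y := by
  refine ⟨fun h => hjx ?_, fun h => hjy ?_, fun h => hxy ?_⟩
  · exact (G.mem_cluster).1 (mem_of_conn_compl_interiorFlip (G.self_mem_cluster Sᶜ j) h)
  · exact (G.mem_cluster).1 (mem_of_conn_compl_interiorFlip (G.self_mem_cluster Sᶜ j) h)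
  · have hx : x ∉ G.cluster Sᶜ j := fun hx => hjx ((G.mem_cluster).1 hx)
    have := (G.mem_cluster).2 h
    rw [cluster_compl_interiorFlip_of_not_mem hx] at this
    exact (G.mem_cluster).1 this

omit G in
/-- First hitting for an arbitrary relation: a walk ending in `Y` is cut at its first vertex in `Y`. -/
theorem exists_first_mem_of_reflTransGen {α : Type*} {r : α → α → Prop} {Y : Set α} {u v : α}
    (h : Relation.ReflTransGen r u v) (hv : v ∈ Y) :
    ∃ w ∈ Y, Relation.ReflTransGen (fun x y => r x y ∧ x ∉ Y) u w := by
  induction h using Relation.ReflTransGen.head_induction_on with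
  | refl => exact ⟨v, hv, Relation.ReflTransGen.refl⟩
  | @head u x hux _ ih =>
    by_cases hu : u ∈ Y
    · exact ⟨u, hu, Relation.ReflTransGen.refl⟩
    · obtain ⟨w, hw, hxw⟩ := ih
      exact ⟨w, hw, Relation.ReflTransGen.head ⟨hux, hu⟩ hxw⟩

/-- Avoiding walks concatenate. -/
theorem WalkAvoiding.trans {ω : Config E} {W : Set V} {u v w : V} (h1 : G.WalkAvoiding ω W u v)
    (h2 : G.WalkAvoiding ω W v w) : G.WalkAvoiding ω W u w :=
  ⟨h1.1, h1.2.trans h2.2⟩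

/-- Appending an open edge into a vertex outside `W` to an avoiding walk. -/
theorem WalkAvoiding.tail {ω : Config E} {W : Set V} {u v w : V} (h : G.WalkAvoiding ω W u v)
    (hvw : G.OpenAdj ω v w) (hw : w ∉ W) : G.WalkAvoiding ω W u w :=
  ⟨h.1, h.2.tail ⟨hvw, hw⟩⟩

/-- If the red reach of `c` avoiding `D_t` meets `Y` at `w`, then after the interior flip of `Y` the
vertex `c` reaches `j` avoiding `D_t`: cut the walk at its first `Y`-vertex and finish inside `Y`. -/
theorem walkAvoiding_interiorFlip_of_reach {S : Config E} {j t c w : V}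
    (hdisj : Disjoint (G.cluster Sᶜ j) (G.cluster Sᶜ t)) (hw : w ∈ G.cluster Sᶜ j)
    (hcw : G.WalkAvoiding S (G.cluster Sᶜ t) c w) :
    G.WalkAvoiding (G.interiorFlip S (G.cluster Sᶜ j)) (G.cluster Sᶜ t) c j := by
  obtain ⟨w', hw', hwalk⟩ := exists_first_mem_of_reflTransGen hcw.2 hw
  have hprefix : G.WalkAvoiding (G.interiorFlip S (G.cluster Sᶜ j)) (G.cluster Sᶜ t) c w' :=
    ⟨hcw.1, reflTransGen_of_imp
      (fun _ _ hxy => ⟨openAdj_interiorFlip_of_not_mem hxy.2 hxy.1.1, hxy.1.2⟩) hwalk⟩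
  exact hprefix.trans
    ((walkInside_interiorFlip_of_mem hw' (G.self_mem_cluster Sᶜ j)).walkAvoiding hdisj)

/-- **The Good-criterion of the interior flip** (mine-3 §41 (c) (2)).  Let `Y = cluster Sᶜ j` be the
blue cluster of `j` and `D_t = cluster Sᶜ t` the blue cluster of a second mark, disjoint from `Y`.
Then `c` reaches `j` in `σ_j(S)` avoiding `D_t` iff `c` reaches `j` in `S` avoiding `D_t`, or the
red reach of `c` in `S` avoiding `D_t` meets `Y`.  For a `Bad_t` source the first alternative is
excluded: `σ_j(S) ∈ Good_t ⟺ R_t(S) ∩ D_j(S) ≠ ∅`. -/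
theorem good_interiorFlip_iff {S : Config E} {j t c : V} (hjt : ¬ G.Conn Sᶜ j t) :
    G.WalkAvoiding (G.interiorFlip S (G.cluster Sᶜ j)) (G.cluster Sᶜ t) c j ↔
      G.WalkAvoiding S (G.cluster Sᶜ t) c j ∨
        ∃ w ∈ G.cluster Sᶜ j, G.WalkAvoiding S (G.cluster Sᶜ t) c w := by
  have hdisj : Disjoint (G.cluster Sᶜ j) (G.cluster Sᶜ t) := disjoint_cluster_of_not_conn hjt
  constructor
  · intro h
    -- every vertex of the walk is red-reachable from `c` in `S` avoiding `D_t`, as long as the walk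
    -- has not entered `Y`; if it enters `Y`, the entry vertex is in the reach
    by_cases hmeet : ∃ w ∈ G.cluster Sᶜ j, G.WalkAvoiding S (G.cluster Sᶜ t) c w
    · exact Or.inr hmeet
    · left
      push Not at hmeet
      refine ⟨h.1, ?_⟩
      have key : ∀ v, Relation.ReflTransGen
          (fun x y => G.OpenAdj (G.interiorFlip S (G.cluster Sᶜ j)) x y ∧ y ∉ G.cluster Sᶜ t) c v →
          G.WalkAvoiding S (G.cluster Sᶜ t) c v := by
        intro v hv
        induction hv with
        | refl => exact ⟨h.1, Relation.ReflTransGen.refl⟩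
        | @tail p q _ hpq ih =>
          have hp : p ∉ G.cluster Sᶜ j := fun hp => hmeet p hp ih
          exact ih.tail (openAdj_of_openAdj_interiorFlip_of_not_mem hp hpq.1) hpq.2
      exact (key j h.2).2
  · rintro (h | ⟨w, hw, hcw⟩)
    · -- a walk avoiding `D_t` in `S` that never enters `Y` is untouched; if it enters `Y` it is cut
      -- there and completed inside `Y`
      by_cases hmeet : ∃ w ∈ G.cluster Sᶜ j, G.WalkAvoiding S (G.cluster Sᶜ t) c w
      · obtain ⟨w, hw, hcw⟩ := hmeet
        exact walkAvoiding_interiorFlip_of_reach hdisj hw hcw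
      · push Not at hmeet
        refine ⟨h.1, ?_⟩
        have key : ∀ v, Relation.ReflTransGen
            (fun x y => G.OpenAdj S x y ∧ y ∉ G.cluster Sᶜ t) c v →
            Relation.ReflTransGen
              (fun x y => G.OpenAdj (G.interiorFlip S (G.cluster Sᶜ j)) x y ∧ y ∉ G.cluster Sᶜ t)
              c v := by
          intro v hv
          induction hv with
          | refl => exact Relation.ReflTransGen.refl
          | @tail p q hcp hpq ih =>
            have hp : p ∉ G.cluster Sᶜ j := fun hp => hmeet p hp ⟨h.1, hcp⟩
            exact ih.tail ⟨openAdj_interiorFlip_of_not_mem hp hpq.1, hpq.2⟩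
        exact key j h.2
    · exact walkAvoiding_interiorFlip_of_reach hdisj hw hcw

end MultiGraph

end PercRepro
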